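import Mathlib.Algebra.BigOperators.Group.Finset.Basic
import Mathlib.Logic.Equiv.Basic
import Literature.Computability.AlgebraicComplexity.ArithCircuit
import HarnessLib

/-!
# Discharges of named facts in `ArithCircuit.lean`: the cost calculus of `complexity`

D-0014 keeps `Literature/` sorry-free by stating cited results as named facts `def X : Prop`.
This sibling file of `Literature.Computability.AlgebraicComplexity.ArithCircuit` proves, from
the definitions alone, the elementary cost calculus of the gate count `complexity`
(Bürgisser 2000, Def. 2.1, §2.1, Rem. 2.2; Bürgisser–Clausen–Shokrollahi 1997, (21.2)–(21.4)):

* `ArithCircuit.exists_computes_size_eq_complexity`: `complexity f` is attained (the defining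
  set is nonempty because every polynomial has a fan-in-two circuit), and the defining
  inequality `complexity_le_size`;
* `complexity_add_le_holds`, `complexity_mul_le_holds`, `complexity_smul_le_holds`:
  `L(f + g), L(f g) ≤ L(f) + L(g) + 1`, `L(c f) ≤ L(f) + 1`;
* `complexity_finset_sum_le`, `complexity_finset_prod_le`: iterated versions,
  `L(∑_{i ∈ s} fᵢ), L(∏_{i ∈ s} fᵢ) ≤ ∑_{i ∈ s} L(fᵢ) + #s`;
* `complexity_rename_le_holds'` (unconditional form of `complexity_rename_le_of_exists`) and
  `complexity_rename_of_injective_holds`: behaviour under renaming of the variables;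
* `circuitSize_le_complexity_holds`.
* `ArithCircuit.exists_wellFormed_of_computes_holds`: junk (forward or out-of-range) gate
  references never help — the normalisation `ArithCircuit.trimJunk` (design note D1 of
  `ArithCircuit.lean`; Bürgisser 2000, Def. 2.1; BCS 1997, Def. (4.2)(1)).

(`complexity_X`, `complexity_C`, `complexity_renameEquiv` and `ArithCircuit.eval_rename` are
already discharged in `ArithCircuit.lean` itself.) These are the ingredients of the standard
membership proof `PER ∈ VNP` (Bürgisser–Clausen–Shokrollahi 1997, Prop. (21.15)), carried out
in `ValiantConjectureProofs.lean`.

## Design notes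

* Every upper bound on `complexity f = sInf {…}` needs the defining set to be *attained*, i.e.
  nonempty; this rests on the semantics `eval_add` / `eval_mul` of the `add` / `mul`
  combinators. Discharges of exactly these facts (`eval_add_holds`, `eval_mul_holds`,
  `gateValues_append_holds`, `exists_computes_holds`, `complexity_attained`, `isFanInTwo_ofVar`,
  `isFanInTwo_ofConst`, `isFanInTwo_add`, `isFanInTwo_mul`) already live, in this namespace, in
  `Summits/ValiantsHypothesis/ValiantsHypothesis/Theorems/StatementJunkGuardArithCircuitExistsComputesProved.lean`.
  `Literature/` must not import `Problems/`, and re-using those names here would make the two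
  modules un-co-importable, so the present file re-proves the semantics as `private` lemmas and
  exports the rest under *distinct* names (`IsFanInTwo.ofVar`, `IsFanInTwo.ofConst`,
  `IsFanInTwo.add`, `IsFanInTwo.mul`, `exists_computes_size_eq_complexity`; each docstring names
  its Problems twin so that a librarian can dedupe later — the Literature copies are meant to
  survive).
* Nothing is stated stronger than the source: `complexity` counts one gate per combinator
  (`add`, `mul`, `smul`), i.e. it is the gate count that `complexity` minimises, and the bounds
  below are those of Bürgisser 2000, Def. 2.1 / BCS 1997, (21.4) for that measure (which is
  Bürgisser's `L_k` only up to a factor `≤ 3`, see the docstring of `complexity`).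

## References

* P. Bürgisser, *Completeness and Reduction in Algebraic Complexity Theory*, Springer 2000,
  Def. 2.1, §2.1, Rem. 2.2.
* P. Bürgisser, M. Clausen, M. A. Shokrollahi, *Algebraic Complexity Theory*, Springer 1997,
  Ch. 21, (21.2)–(21.4), p. 569–570.
-/

noncomputable section

open MvPolynomial

namespace Literature.Computability.AlgebraicComplexity

universe u v w

namespace ArithCircuit

variable {k : Type u} {σ : Type v} {τ : Type w}

/-! ### Sizes and fan-in of the combinators -/

/-- Shifting gate references does not change the fan-in (Problems twin: `Gate.fanIn_shift`). [folklore] -/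
private theorem fanIn_shift_aux (n : ℕ) (g : Gate k σ) : (g.shift n).fanIn = g.fanIn := by
  cases g <;> simp [Gate.shift, Gate.fanIn, Gate.args]

/-- The sum combinator adds exactly one gate (Bürgisser 2000, Def. 2.1). [cite: Burgisser2000, Def. 2.1] -/
@[simp]
theorem size_add [CommSemiring k] (P Q : ArithCircuit k σ) :
    (P.add Q).size = P.size + Q.size + 1 := by
  simp [add, append, size, Nat.add_assoc]

/-- The product combinator adds exactly one gate (Bürgisser 2000, Def. 2.1). [cite: Burgisser2000, Def. 2.1] -/
@[simp]
theorem size_mul [Zero k] (P Q : ArithCircuit k σ) :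
    (P.mul Q).size = P.size + Q.size + 1 := by
  simp [mul, append, size, Nat.add_assoc]

/-- The scalar-multiple combinator adds exactly one gate (Bürgisser 2000, Def. 2.1). [cite: Burgisser2000, Def. 2.1] -/
@[simp]
theorem size_smul (c : k) (P : ArithCircuit k σ) : (P.smul c).size = P.size + 1 := by
  simp [smul, size]

/-- `add` preserves fan-in two: the new gate has two operands (Problems twin: `isFanInTwo_add`). [folklore] -/
theorem IsFanInTwo.add [CommSemiring k] {P Q : ArithCircuit k σ} (hP : P.IsFanInTwo)
    (hQ : Q.IsFanInTwo) : (P.add Q).IsFanInTwo := by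
  intro g hg
  simp only [ArithCircuit.add, append, List.mem_append, List.mem_map, List.mem_singleton] at hg
  rcases hg with (hg | ⟨g0, hg0, rfl⟩) | rfl
  · exact hP g hg
  · rw [fanIn_shift_aux]; exact hQ g0 hg0
  · simp [Gate.fanIn, Gate.args]

/-- `mul` preserves fan-in two: the new gate has two operands (Problems twin: `isFanInTwo_mul`,
stated there under `CommSemiring k`). [folklore] -/
theorem IsFanInTwo.mul [Zero k] {P Q : ArithCircuit k σ} (hP : P.IsFanInTwo)
    (hQ : Q.IsFanInTwo) : (P.mul Q).IsFanInTwo := by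
  intro g hg
  simp only [ArithCircuit.mul, append, List.mem_append, List.mem_map, List.mem_singleton] at hg
  rcases hg with (hg | ⟨g0, hg0, rfl⟩) | rfl
  · exact hP g hg
  · rw [fanIn_shift_aux]; exact hQ g0 hg0
  · simp [Gate.fanIn, Gate.args]

/-- `smul` preserves fan-in two: the new gate has one operand. [folklore] -/
theorem IsFanInTwo.smul {c : k} {P : ArithCircuit k σ} (hP : P.IsFanInTwo) :
    (P.smul c).IsFanInTwo := by
  intro g hg
  simp only [ArithCircuit.smul, List.mem_append, List.mem_singleton] at hg
  rcases hg with hg | rfl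
  · exact hP g hg
  · simp [Gate.fanIn, Gate.args]

/-- The gate-free circuit `ofVar i` has fan-in two, vacuously (Problems twin:
`isFanInTwo_ofVar`). [folklore] -/
theorem IsFanInTwo.ofVar (i : σ) : (ofVar i : ArithCircuit k σ).IsFanInTwo := by
  simp [IsFanInTwo, ArithCircuit.ofVar]

/-- The gate-free circuit `ofConst c` has fan-in two, vacuously (Problems twin:
`isFanInTwo_ofConst`). [folklore] -/
theorem IsFanInTwo.ofConst (c : k) : (ofConst c : ArithCircuit k σ).IsFanInTwo := by
  simp [IsFanInTwo, ArithCircuit.ofConst]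

/-! ### Private semantics of `add` / `mul` (public twins in the Problems junk-guard file) -/

variable [CommSemiring k]

/-- A shifted gate evaluated against `pre ++ vals` (shift `= pre.length`) reads `vals`
(Problems twin: `Gate.eval_shift_append`). [folklore] -/
private theorem gate_eval_shift_append (pre vals : List (MvPolynomial σ k)) (g : Gate k σ) :
    (g.shift pre.length).eval (pre ++ vals) = g.eval vals := by
  cases g with
  | sum args =>
    simp [Gate.shift, Gate.eval, List.map_map, Function.comp_def, Operand.eval_shift_append]
  | prod args =>
    simp [Gate.shift, Gate.eval, List.map_map, Function.comp_def, Operand.eval_shift_append]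

/-- The left fold over shifted gates with a prefix of values (Problems twin: `foldl_shift`). [folklore] -/
private theorem foldl_shift_aux (pre : List (MvPolynomial σ k)) (gs : List (Gate k σ))
    (vals : List (MvPolynomial σ k)) :
    (gs.map (Gate.shift pre.length)).foldl (fun vals g => vals ++ [g.eval vals]) (pre ++ vals)
      = pre ++ gs.foldl (fun vals g => vals ++ [g.eval vals]) vals := by
  induction gs generalizing vals with
  | nil => simp
  | cons g rest ih =>
    simp only [List.map_cons, List.foldl_cons]
    rw [gate_eval_shift_append, List.append_assoc, ih]

/-- Private discharge of `gateValues_append` (Problems twin: `gateValues_append_holds`). [folklore] -/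
private theorem gateValues_append_aux (P Q : ArithCircuit k σ) :
    gateValues (P.append Q).gates = gateValues P.gates ++ gateValues Q.gates := by
  show gateValues (P.gates ++ Q.gates.map (Gate.shift P.size)) = _
  have hP : P.size = (gateValues P.gates).length := (gateValues_length (k := k) P.gates).symm
  unfold gateValues
  rw [List.foldl_append, hP]
  have := foldl_shift_aux (k := k) (σ := σ) (gateValues P.gates) Q.gates []
  simpa [gateValues] using this

/-- Private discharge of `eval_add` (Problems twin: `eval_add_holds`). [folklore] -/
private theorem eval_add_aux (P Q : ArithCircuit k σ) : (P.add Q).eval = P.eval + Q.eval := by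
  have hP := gateValues_length (k := k) P.gates
  have hQ := gateValues_length (k := k) Q.gates
  have h1 := Operand.eval_truncate_append (gateValues P.gates) (gateValues Q.gates) P.output
  have h2 := Operand.eval_shift_append (gateValues P.gates) (gateValues Q.gates) Q.output
  rw [hP] at h1 h2
  simp [eval, add, gateValues_append_aux, Gate.eval, size, List.getD_eq_getElem?_getD, hP, hQ,
    h1, h2]

/-- Private discharge of `eval_mul` (Problems twin: `eval_mul_holds`). [folklore] -/
private theorem eval_mul_aux (P Q : ArithCircuit k σ) : (P.mul Q).eval = P.eval * Q.eval := by
  have hP := gateValues_length (k := k) P.gates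
  have hQ := gateValues_length (k := k) Q.gates
  have h1 := Operand.eval_truncate_append (gateValues P.gates) (gateValues Q.gates) P.output
  have h2 := Operand.eval_shift_append (gateValues P.gates) (gateValues Q.gates) Q.output
  rw [hP] at h1 h2
  simp [eval, mul, gateValues_append_aux, Gate.eval, size, List.getD_eq_getElem?_getD, hP, hQ,
    h1, h2]

/-- Every polynomial is computed by some fan-in-two circuit (sum of monomials; Bürgisser 2000,
§2.1), so the set defining `complexity f` is nonempty (Problems twins:
`exists_isFanInTwo_computes`, and the well-formed strengthening `exists_computes_holds`). [cite: Burgisser2000, §2.1] -/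
private theorem exists_isFanInTwo_computes_aux (f : MvPolynomial σ k) :
    ∃ P : ArithCircuit k σ, P.IsFanInTwo ∧ P.Computes f := by
  induction f using MvPolynomial.induction_on with
  | C a => exact ⟨ofConst a, IsFanInTwo.ofConst a, rfl⟩
  | add p q hp hq =>
    obtain ⟨P, hP1, hP2⟩ := hp
    obtain ⟨Q, hQ1, hQ2⟩ := hq
    refine ⟨P.add Q, hP1.add hQ1, ?_⟩
    rw [Computes] at hP2 hQ2 ⊢
    rw [eval_add_aux, hP2, hQ2]
  | mul_X p i hp =>
    obtain ⟨P, hP1, hP2⟩ := hp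
    refine ⟨P.mul (ofVar i), hP1.mul (IsFanInTwo.ofVar i), ?_⟩
    rw [Computes] at hP2 ⊢
    rw [eval_mul_aux, hP2, eval_ofVar]

/-- `complexity f` is attained: some fan-in-two circuit of size exactly `L(f)` computes `f`
(no `sInf ∅` junk; Bürgisser 2000, Def. 2.1; Problems twin: `complexity_attained`). [cite: Burgisser2000, Def. 2.1] -/
theorem exists_computes_size_eq_complexity (f : MvPolynomial σ k) :
    ∃ P : ArithCircuit k σ, P.IsFanInTwo ∧ P.Computes f ∧ P.size = complexity f := by
  obtain ⟨P, h1, h2⟩ := exists_isFanInTwo_computes_aux f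
  exact Nat.sInf_mem (⟨P.size, P, h1, h2, rfl⟩ : Set.Nonempty {s | ∃ P : ArithCircuit k σ,
    P.IsFanInTwo ∧ P.Computes f ∧ P.size = s})

/-- The defining inequality: any fan-in-two circuit computing `f` bounds `L(f)` by its size
(Bürgisser 2000, Def. 2.1). [cite: Burgisser2000, Def. 2.1] -/
theorem complexity_le_size {P : ArithCircuit k σ} {f : MvPolynomial σ k} (h2 : P.IsFanInTwo)
    (hf : P.Computes f) : complexity f ≤ P.size :=
  Nat.sInf_le ⟨P, h2, hf, rfl⟩

end ArithCircuit

section ComplexityLemmas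

variable {k : Type u} {σ : Type v} {τ : Type w} [CommSemiring k]

open ArithCircuit

/-- Discharge of `complexity_add_le`: `L(f + g) ≤ L(f) + L(g) + 1` (Bürgisser 2000, §2.1;
BCS 1997, (21.4)). [cite: Burgisser2000, §2.1] -/
theorem complexity_add_le_holds : complexity_add_le (k := k) (σ := σ) := by
  intro f g
  obtain ⟨P, hP1, hP2, hP3⟩ := exists_computes_size_eq_complexity f
  obtain ⟨Q, hQ1, hQ2, hQ3⟩ := exists_computes_size_eq_complexity g
  rw [← hP3, ← hQ3, ← size_add P Q]
  refine complexity_le_size (hP1.add hQ1) ?_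
  rw [Computes] at hP2 hQ2 ⊢
  rw [ArithCircuit.eval_add_aux, hP2, hQ2]

/-- Discharge of `complexity_mul_le`: `L(f g) ≤ L(f) + L(g) + 1` (Bürgisser 2000, §2.1;
BCS 1997, (21.4)). [cite: Burgisser2000, §2.1] -/
theorem complexity_mul_le_holds : complexity_mul_le (k := k) (σ := σ) := by
  intro f g
  obtain ⟨P, hP1, hP2, hP3⟩ := exists_computes_size_eq_complexity f
  obtain ⟨Q, hQ1, hQ2, hQ3⟩ := exists_computes_size_eq_complexity g
  rw [← hP3, ← hQ3, ← size_mul P Q]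
  refine complexity_le_size (hP1.mul hQ1) ?_
  rw [Computes] at hP2 hQ2 ⊢
  rw [ArithCircuit.eval_mul_aux, hP2, hQ2]

/-- Discharge of `complexity_smul_le`: `L(c • f) ≤ L(f) + 1` (Bürgisser 2000, §2.1). [cite: Burgisser2000, §2.1] -/
theorem complexity_smul_le_holds : complexity_smul_le (k := k) (σ := σ) := by
  intro c f
  obtain ⟨P, hP1, hP2, hP3⟩ := exists_computes_size_eq_complexity f
  rw [← hP3, ← size_smul c P]
  refine complexity_le_size hP1.smul ?_
  rw [Computes] at hP2 ⊢
  rw [eval_smul, hP2]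

/-- Iterated subadditivity: `L(∑_{i ∈ s} fᵢ) ≤ ∑_{i ∈ s} L(fᵢ) + #s` (one addition gate per
summand; Bürgisser 2000, §2.1; BCS 1997, (21.4)). [cite: Burgisser2000, §2.1] -/
theorem complexity_finset_sum_le {ι : Type*} (s : Finset ι) (f : ι → MvPolynomial σ k) :
    complexity (∑ i ∈ s, f i) ≤ ∑ i ∈ s, complexity (f i) + s.card := by
  classical
  induction s using Finset.induction_on with
  | empty => simpa using complexity_C_holds (σ := σ) (0 : k)
  | insert a s ha ih =>
    rw [Finset.sum_insert ha, Finset.sum_insert ha, Finset.card_insert_of_notMem ha]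
    calc complexity (f a + ∑ i ∈ s, f i)
        ≤ complexity (f a) + complexity (∑ i ∈ s, f i) + 1 := complexity_add_le_holds _ _
      _ ≤ complexity (f a) + (∑ i ∈ s, complexity (f i) + s.card) + 1 := by gcongr
      _ = _ := by ring

/-- Iterated submultiplicativity: `L(∏_{i ∈ s} fᵢ) ≤ ∑_{i ∈ s} L(fᵢ) + #s` (one product gate
per factor; Bürgisser 2000, §2.1; BCS 1997, (21.4)). [cite: Burgisser2000, §2.1] -/
theorem complexity_finset_prod_le {ι : Type*} (s : Finset ι) (f : ι → MvPolynomial σ k) :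
    complexity (∏ i ∈ s, f i) ≤ ∑ i ∈ s, complexity (f i) + s.card := by
  classical
  induction s using Finset.induction_on with
  | empty => simpa using complexity_C_holds (σ := σ) (1 : k)
  | insert a s ha ih =>
    rw [Finset.prod_insert ha, Finset.sum_insert ha, Finset.card_insert_of_notMem ha]
    calc complexity (f a * ∏ i ∈ s, f i)
        ≤ complexity (f a) + complexity (∏ i ∈ s, f i) + 1 := complexity_mul_le_holds _ _
      _ ≤ complexity (f a) + (∑ i ∈ s, complexity (f i) + s.card) + 1 := by gcongr
      _ = _ := by ring

/-- Discharge of `complexity_rename_le`: `L(rename e f) ≤ L(f)` for every `e`, unconditionally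
(`complexity_rename_le_of_exists` fed with attainment; Bürgisser 2000, Rem. 2.2). Primed
because the unprimed name `complexity_rename_le_holds` is occupied, in this namespace, by
`Summits/ValiantsHypothesis/ValiantsHypothesis/Theorems/StatementJunkGuardArithCircuitExistsComputesProved.lean`
(precedent: `ArithCircuit.eval_rename_holds'`). [cite: Burgisser2000, Rem. 2.2] -/
theorem complexity_rename_le_holds' : complexity_rename_le (k := k) (σ := σ) (τ := τ) := by
  intro e f
  obtain ⟨P, h1, h2, -⟩ := exists_computes_size_eq_complexity f
  exact complexity_rename_le_of_exists e ⟨P, h1, h2⟩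

/-- Discharge of `complexity_rename_of_injective`: renaming along an injective map preserves
complexity (rename back along a left inverse; over an empty variable type both sides are
constants; Bürgisser 2000, Rem. 2.2). [cite: Burgisser2000, Rem. 2.2] -/
theorem complexity_rename_of_injective_holds :
    complexity_rename_of_injective (k := k) (σ := σ) (τ := τ) := by
  intro e he f
  refine le_antisymm (complexity_rename_le_holds' e f) ?_
  cases isEmpty_or_nonempty σ with
  | inl h =>
    rw [eq_C_of_isEmpty f, complexity_C_holds]
    exact Nat.zero_le _
  | inr h =>
    obtain ⟨g, hg⟩ := he.hasLeftInverse
    calc complexity f = complexity (MvPolynomial.rename g (MvPolynomial.rename e f)) := by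
          rw [rename_rename, hg.comp_eq_id, rename_id]; rfl
      _ ≤ complexity (MvPolynomial.rename e f) := complexity_rename_le_holds' g _

/-- Discharge of `circuitSize_le_complexity`: dropping the fan-in restriction can only lower the
minimal size (Bürgisser 2000, Def. 2.1 / §2.1). [cite: Burgisser2000, Def. 2.1 / §2.1] -/
theorem circuitSize_le_complexity_holds : circuitSize_le_complexity (k := k) (σ := σ) := by
  intro f
  obtain ⟨P, -, hP2, hP3⟩ := exists_computes_size_eq_complexity f
  rw [← hP3]
  exact Nat.sInf_le ⟨P, hP2, rfl⟩

end ComplexityLemmas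

/-! ### Discharge: junk references never help (`ArithCircuit.exists_wellFormed_of_computes`)

In Bürgisser's model a straight-line program is well formed by definition: instruction `Γᵢ` may
only use the results of earlier instructions (Bürgisser 2000, Def. 2.1;
Bürgisser–Clausen–Shokrollahi 1997, Def. (4.2)(1): the operand indices `u_{iℓ}` of `Γᵢ` satisfy
`-n < u_{iℓ} < i`). The total fold semantics `ArithCircuit.eval` also accepts forward or
out-of-range references `gate j` and gives them the junk value `0`. `ArithCircuit.trimJunk`
replaces every such reference — in gate number `i` those with `i ≤ j`, in the output those with
`size ≤ j` — by the operand `const 0`, which has the same value (`Operand.eval_truncate`). The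
result is well formed, has the same number of gates and the same value list, hence computes the
same polynomial, and the replacement `gate j ↦ const 0` changes neither the fan-in of a gate nor
the sign-constant property (`0 ∈ {0, 1, -1}`). This is design note D1 of `ArithCircuit.lean`,
vendored there as the named fact `ArithCircuit.exists_wellFormed_of_computes` and proved here as
`ArithCircuit.exists_wellFormed_of_computes_holds`. The two operand-level steps are `private`
copies: `Operand.refsBelow_truncate` is declared in
`Summits/ValiantsHypothesis/ValiantsHypothesis/Theorems/StatementJunkGuardArithCircuitExistsComputesProved.lean`
and `Operand.HasSignConstants.truncate` in `ConstantFreeCircuits.lean` (which imports this file),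
with these statements. -/

namespace ArithCircuit

variable {k : Type u} {σ : Type v}

section TrimJunk

variable [Zero k]

/-- Truncate every operand of a gate at `n` (`Operand.truncate`: a junk reference `gate j` with
`n ≤ j` becomes `const 0`), keeping the coefficients of a sum gate; for `n = i` this turns gate
number `i` into an instruction using only earlier results (Bürgisser 2000, Def. 2.1;
BCS 1997, Def. (4.2)(1)). [cite: Burgisser2000, Def. 2.1] -/
def Gate.truncate (n : ℕ) : Gate k σ → Gate k σ
  | .sum args => .sum (args.map fun a => (a.1, a.2.truncate n))
  | .prod args => .prod (args.map (Operand.truncate n))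

/-- The well-formed circuit obtained from `P` by replacing every junk gate reference by the
operand `const 0`: gate number `i` is truncated at `i` and the output operand at `P.size`
(design note D1; Bürgisser 2000, Def. 2.1). [cite: Burgisser2000, Def. 2.1] -/
def trimJunk (P : ArithCircuit k σ) : ArithCircuit k σ where
  gates := P.gates.mapIdx fun i g => g.truncate i
  output := P.output.truncate P.size

/-- The operands of a truncated gate are the truncated operands (Bürgisser 2000, Def. 2.1). [cite: Burgisser2000, Def. 2.1] -/
theorem Gate.args_truncate (n : ℕ) (g : Gate k σ) :
    (g.truncate n).args = g.args.map (Operand.truncate n) := by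
  cases g <;> simp [Gate.truncate, Gate.args, List.map_map, Function.comp_def]

/-- Truncation does not change the fan-in of a gate (Bürgisser 2000, Def. 2.1). [cite: Burgisser2000, Def. 2.1] -/
@[simp]
theorem Gate.fanIn_truncate (n : ℕ) (g : Gate k σ) : (g.truncate n).fanIn = g.fanIn := by
  simp [Gate.fanIn, Gate.args_truncate]

/-- An operand truncated at `n` references only gates below `n` (twin of
`Operand.refsBelow_truncate` in the Summits junk-guard file; Bürgisser 2000, Def. 2.1). [cite: Burgisser2000, Def. 2.1] -/
private theorem Operand.refsBelow_truncate_self (n : ℕ) (u : Operand k σ) :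
    (u.truncate n).RefsBelow n := by
  cases u with
  | var i => trivial
  | const c => trivial
  | gate j =>
    by_cases h : j < n
    · simp only [Operand.truncate, h, if_true]; exact h
    · simp only [Operand.truncate, h, if_false]; trivial

/-- `trimJunk` keeps the number of gates (Bürgisser 2000, Def. 2.1). [cite: Burgisser2000, Def. 2.1] -/
@[simp]
theorem size_trimJunk (P : ArithCircuit k σ) : P.trimJunk.size = P.size := by
  simp [trimJunk, size]

/-- `trimJunk P` is well formed: gate `i` references only gates `j < i`, the output only gates
`j < size` (Bürgisser 2000, Def. 2.1; BCS 1997, Def. (4.2)(1)). [cite: Burgisser2000, Def. 2.1] -/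
theorem wellFormed_trimJunk (P : ArithCircuit k σ) : P.trimJunk.WellFormed := by
  refine ⟨fun i g hg u hu => ?_, ?_⟩
  · simp only [trimJunk, List.getElem?_mapIdx, Option.map_eq_some_iff] at hg
    obtain ⟨g₀, -, rfl⟩ := hg
    rw [Gate.args_truncate, List.mem_map] at hu
    obtain ⟨u₀, -, rfl⟩ := hu
    exact Operand.refsBelow_truncate_self i u₀
  · rw [size_trimJunk]
    exact Operand.refsBelow_truncate_self P.size P.output

/-- `trimJunk` preserves fan-in two (each gate keeps its fan-in; Bürgisser 2000, Def. 2.1). [cite: Burgisser2000, Def. 2.1] -/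
theorem IsFanInTwo.trimJunk {P : ArithCircuit k σ} (h : P.IsFanInTwo) :
    P.trimJunk.IsFanInTwo := by
  intro g hg
  simp only [ArithCircuit.trimJunk, List.mem_mapIdx] at hg
  obtain ⟨i, hi, rfl⟩ := hg
  rw [Gate.fanIn_truncate]
  exact h _ (List.getElem_mem hi)

section SignConstants

variable [One k] [Add k]

/-- Truncation preserves sign constants of an operand: a truncated junk reference becomes
`const 0` and `0 ∈ {0, 1, -1}` (twin of `Operand.HasSignConstants.truncate` in
`ConstantFreeCircuits.lean`; Bürgisser 2000, §1.4). [cite: Burgisser2000, §1.4] -/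
private theorem Operand.hasSignConstants_truncate_of (n : ℕ) {u : Operand k σ}
    (h : u.HasSignConstants) : (u.truncate n).HasSignConstants := by
  cases u with
  | var i => trivial
  | const c => exact h
  | gate j =>
    by_cases hj : j < n
    · simp only [Operand.truncate, hj, if_true]; trivial
    · simp only [Operand.truncate, hj, if_false]; exact Or.inl rfl

/-- Truncation preserves sign constants of a gate (coefficients are kept, operands truncated;
Bürgisser 2000, §1.4). [cite: Burgisser2000, §1.4] -/
private theorem Gate.hasSignConstants_truncate_of (n : ℕ) {g : Gate k σ}
    (h : g.HasSignConstants) : (g.truncate n).HasSignConstants := by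
  cases g with
  | sum args =>
    simp only [Gate.truncate, Gate.HasSignConstants, List.mem_map]
    rintro _ ⟨a, ha, rfl⟩
    exact ⟨(h a ha).1, Operand.hasSignConstants_truncate_of n (h a ha).2⟩
  | prod args =>
    simp only [Gate.truncate, Gate.HasSignConstants, List.mem_map]
    rintro _ ⟨u, hu, rfl⟩
    exact Operand.hasSignConstants_truncate_of n (h u hu)

/-- `trimJunk` preserves the constant-free property: all constants and coefficients stay in
`{0, 1, -1}`, new constants are `0` (Bürgisser 2000, §1.4; Malod 2003). [cite: Burgisser2000, §1.4] -/
theorem HasSignConstants.trimJunk {P : ArithCircuit k σ} (h : P.HasSignConstants) :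
    P.trimJunk.HasSignConstants := by
  refine ⟨fun g hg => ?_, Operand.hasSignConstants_truncate_of P.size h.2⟩
  simp only [ArithCircuit.trimJunk, List.mem_mapIdx] at hg
  obtain ⟨i, hi, rfl⟩ := hg
  exact Gate.hasSignConstants_truncate_of i (h.1 _ (List.getElem_mem hi))

end SignConstants

end TrimJunk

section TrimJunkSemantics

variable [CommSemiring k]

/-- A gate truncated at the length of the value list has the same value: junk references and
`const 0` both evaluate to `0` (`Operand.eval_truncate`; Bürgisser 2000, Def. 2.1). [cite: Burgisser2000, Def. 2.1] -/
theorem Gate.eval_truncate (vals : List (MvPolynomial σ k)) (g : Gate k σ) :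
    (g.truncate vals.length).eval vals = g.eval vals := by
  cases g with
  | sum args =>
    simp [Gate.truncate, Gate.eval, List.map_map, Function.comp_def, Operand.eval_truncate]
  | prod args =>
    simp [Gate.truncate, Gate.eval, List.map_map, Function.comp_def, Operand.eval_truncate]

/-- Truncating gate `i` at `i`, for every `i`, does not change the value list (induction along
the fold; Bürgisser 2000, Def. 2.1). [cite: Burgisser2000, Def. 2.1] -/
theorem gateValues_mapIdx_truncate (gs : List (Gate k σ)) :
    gateValues (gs.mapIdx fun i g => g.truncate i) = gateValues gs := by
  induction gs using List.reverseRecOn with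
  | nil => rfl
  | append_singleton gs g ih =>
    have h := Gate.eval_truncate (gateValues gs) g
    rw [gateValues_length] at h
    rw [List.mapIdx_concat, gateValues_append_singleton, gateValues_append_singleton, ih, h]

/-- `trimJunk P` has the same value list as `P` (Bürgisser 2000, Def. 2.1). [cite: Burgisser2000, Def. 2.1] -/
theorem gateValues_trimJunk (P : ArithCircuit k σ) :
    gateValues P.trimJunk.gates = gateValues P.gates :=
  gateValues_mapIdx_truncate P.gates

/-- `trimJunk P` computes the same polynomial as `P` (Bürgisser 2000, Def. 2.1). [cite: Burgisser2000, Def. 2.1] -/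
@[simp]
theorem eval_trimJunk (P : ArithCircuit k σ) : P.trimJunk.eval = P.eval := by
  have h := Operand.eval_truncate (gateValues P.gates) P.output
  rw [gateValues_length] at h
  change (P.output.truncate P.gates.length).eval (gateValues P.trimJunk.gates) =
    P.output.eval (gateValues P.gates)
  rw [gateValues_trimJunk, h]

/-- If `P` computes `f` then so does `trimJunk P` (Bürgisser 2000, Def. 2.1). [cite: Burgisser2000, Def. 2.1] -/
theorem Computes.trimJunk {P : ArithCircuit k σ} {f : MvPolynomial σ k} (h : P.Computes f) :
    P.trimJunk.Computes f := by
  unfold Computes at h ⊢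
  rw [eval_trimJunk, h]

/-- Discharge of the named fact `ArithCircuit.exists_wellFormed_of_computes`: junk (forward or
out-of-range) gate references never help — `trimJunk P` is well formed, computes the same
polynomial, has the same size, and keeps fan-in two and sign constants (design note D1 of the
outline; Bürgisser 2000, Def. 2.1; BCS 1997, Def. (4.2)(1)). [cite: Burgisser2000, Def. 2.1] -/
theorem exists_wellFormed_of_computes_holds :
    exists_wellFormed_of_computes (k := k) (σ := σ) := by
  intro P f h
  exact ⟨P.trimJunk, wellFormed_trimJunk P, h.trimJunk, size_trimJunk P, IsFanInTwo.trimJunk,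
    HasSignConstants.trimJunk⟩

end TrimJunkSemantics

end ArithCircuit

end Literature.Computability.AlgebraicComplexity
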